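/-
Copyright (c) 2026 the pub-hodgecm-mathlib formalisation cell (harness21).  Prover seat hodgecm-mathlib-K2E3-p12 (g8), Track B ∕ K2-LIT, h413 = `stmt-HodgeConjecture-24833`,
line `K2_E1_TraceFormulaBeta`, 5Res ROADCARD (154)∕(263)∕(271): the `hSD` LETTER OF ★ p860865 `K2E1ChiSectionPlancherelSelfDualM1CMTwo.exists_linearIsometry_chiSection_selfDual_m1_cm_two`
PAID in its own bytes (scalar Gram currency `s z * ⟪ṽ_b, ṽ_a⟫`) from ★ `K2E1ChiSectionPlancherelSDGramM1CMTwo` — for the canonical representatives `y i a = [θ_{f_{ia},φ_a}]`, `v a = [φ_a|_{K_U}]`.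
-/
import Summits.HodgeConjecture.HodgeConjecture.Theorems.K2E1ChiSectionPlancherelSDGramM1CMTwo       -- ★ p860890 (this seat): (SD) at M1 with the scalar Gram coefficient
import Summits.HodgeConjecture.HodgeConjecture.Theorems.K2E1ChiSectionPlancherelSelfDualCMTwo      -- ★ p860386: `inner_mk_span_eq_integral` (+ ★ p860123 `inner_eq_integral_mul_conj`)
import HarnessLib

/-!
# (271) — `K2E1ChiSectionPlancherelSDGramLetterM1CMTwo`: THE `hSD` LETTER AT M1, PAID
# `⟪y_{ib}, y_{ja}⟫ = C·(2π)⁻¹∫_ℝ f̃_{ja}(−z)·( ⟪ṽ_b,ṽ_a⟫·conj f̃_{ib}(−(1−z̄)) + s(z)·⟪ṽ_b,ṽ_a⟫·conj f̃_{ib}(−z̄) ) dt` for `y_{ia} = [θ_{f_{ia},φ_a}]`, `v_a = [φ_a|_{K_U}]` (`z = σ₀ + it`, `σ₀ > 1`)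

Track B ∕ K2-LIT, crux h413 = `stmt-HodgeConjecture-24833`, route of record `HCCMUnconditional`; cell `hodgecm-mathlib`, squad K2, ENGINE E1.  THEOREMS ONLY (no `def`, no `instance`,
no `notation`, no named-fact hypothesis, no `sorry`); lane `--supports stmt-HodgeConjecture-24833 --as helper` (count-neutral).  Hypothesis-first ONLY on the (SD) M1 package letters
`hs_tube` (per section; ★ `scatteringScalar_tube_of_coords`) and `hconj` (★ `chi_scattering_conj_symm_m1_cm_two` on the tube) — exactly the letters the consumer ★ p860865 already carries.
THE MATHEMATICS ([MoeglinWaldspurger1995, II.2.1, IV.1.10]; dealer (263)∕(271)).  ★ p860890 gives `∫_X θ_{f,φ}·conj θ_{f′,φ′} = C·(2π)⁻¹∫ f̃(−z)·(⟪φ,φ′⟫_K·conj f̃′(−(1−z̄)) + (s z·⟪φ,φ′⟫_K)·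
conj f̃′(−z̄)) dt` for `K_U`-invariant `χ`-sections at maximal level; ★ p860123 `inner_eq_integral_mul_conj` turns `⟪y_{ib}, y_{ja}⟫` into that pairing for `L²(X,μ)`-representatives and
★ p860386 `inner_mk_span_eq_integral` turns `⟪ṽ_b, ṽ_a⟫` (in `span{v_a} ≤ L²(K_U)`) into `∫_{K_U} φ_a·conj φ_b dμ_K`: the `hSD` letter of ★ p860865 follows byte for byte.
* §1 **`hSD_m1_cm_two`**.
HONEST LABEL: HC_CM is proved only modulo the 7 printed citations (2 remaining named inputs: hLiu418 = `stmt-HodgeConjecture-24832`, h413 = `stmt-HodgeConjecture-24833`) until rung 0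
closes; this file asserts no named fact, closes no socket; count-neutral; letters: the (SD) M1 package clauses `hs_tube`∕`hconj` only (★ payers cited).

## References
* [MoeglinWaldspurger1995] C. Mœglin, J.-L. Waldspurger, *Spectral decomposition and Eisenstein series* (1995), II.2.1, IV.1.10.
-/

set_option autoImplicit false
set_option linter.dupNamespace false  -- the mandated namespace repeats the summit's segment (`HodgeConjecture.HodgeConjecture`)

noncomputable section

open MeasureTheory Measure Set Filter Topology Complex NumberField IsDedekindDomain MulAction
open scoped Real NNReal ENNReal ComplexConjugate Pointwise InnerProductSpace
open Literature.MeasureTheory.Group Literature.NumberTheory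
open Literature.NumberTheory.Automorphic Literature.NumberTheory.Automorphic.UnitaryGroup AdelicGroupData
open Literature.NumberTheory.GaloisRepresentations (HeckeCharacter ideleGroup)
open Summit.HodgeConjecture.HodgeConjecture.Cruxes.H413.K2E1BorelEisensteinU
open Summit.HodgeConjecture.HodgeConjecture.Cruxes.H413.K2E1CharacterEisensteinU2Defs
open Summit.HodgeConjecture.HodgeConjecture.Cruxes.H413.K2E1ChiSectionPlancherelSDGramM1CMTwo (chiPseudoEisenstein_inner_product_selfDual_scalarGram_m1_cm_two)
open Summit.HodgeConjecture.HodgeConjecture.Cruxes.H413.K2E1ChiSectionPlancherelSelfDualCMTwo (inner_mk_span_eq_integral)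
open Summit.HodgeConjecture.HodgeConjecture.Cruxes.H413.K2E1ChiSectionPlancherelKTypeCMTwo (inner_eq_integral_mul_conj)

namespace Summit.HodgeConjecture.HodgeConjecture.Cruxes.H413.K2E1ChiSectionPlancherelSDGramLetterM1CMTwo

variable (L : Type) [Field L] [NumberField L] [IsCMField L]
variable [MeasurableSpace (quasiSplit (↥(maximalRealSubfield L)) L (IsCMField.complexConj L) 2).Adelic] [BorelSpace (quasiSplit (↥(maximalRealSubfield L)) L (IsCMField.complexConj L) 2).Adelic]
variable [MeasurableSpace (AdeleRing (𝓞 L) L)ˣ] [BorelSpace (AdeleRing (𝓞 L) L)ˣ]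

/-- **THE `hSD` LETTER OF ★ p860865 AT M1, PAID.**  Data as in ★ W-b; one `C > 0` such that for every UNITARY SELF-DUAL `χ`, every finite family of continuous bounded RIGHT-`K_U`-INVARIANT
`χ`-sections `φ_a` with `φ_a(1) ≠ 0`, a scalar `s` with the tube formula for each `φ_a` and `s(z̄) = conj s(z)` on the tube, profiles `f_{ia} ∈ C²_c((0,∞))`, `σ₀ > 1`, and ANY
`L²`-representatives `v_a =ᵐ φ_a|_{K_U}`, `y_{ia} =ᵐ θ_{f_{ia},φ_a}`: the Gram identity `hSD` of ★ `exists_linearIsometry_chiSection_selfDual_m1_cm_two` holds verbatim.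
[cite: MoeglinWaldspurger1995, II.2.1, IV.1.10] -/
theorem hSD_m1_cm_two
    (μ : Measure (quasiSplit (↥(maximalRealSubfield L)) L (IsCMField.complexConj L) 2).automorphicQuotient) [(quasiSplit (↥(maximalRealSubfield L)) L (IsCMField.complexConj L) 2).IsAutomorphicMeasure μ]
    (νG : Measure (quasiSplit (↥(maximalRealSubfield L)) L (IsCMField.complexConj L) 2).Adelic) [νG.IsHaarMeasure] [νG.IsInvInvariant]
    (μK : Measure ((standardMaximalCompactGL 2 L).comap (adelicVal (↥(maximalRealSubfield L)) L (IsCMField.complexConj L) 2 ((StdForm.antidiagonal 2).over L)) : Subgroup (quasiSplit (↥(maximalRealSubfield L)) L (IsCMField.complexConj L) 2).Adelic)) [μK.IsHaarMeasure]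
    (νI : Measure (AdeleRing (𝓞 L) L)ˣ) [νI.IsHaarMeasure]
    {𝓕I : Set (AdeleRing (𝓞 L) L)ˣ} (h𝓕I : IsIdeleClassDomain L 𝓕I)
    (ν : Measure ↥(adelicUnipotent (↥(maximalRealSubfield L)) L (IsCMField.complexConj L) 2)) [ν.IsHaarMeasure] {𝓕 : Set ↥(adelicUnipotent (↥(maximalRealSubfield L)) L (IsCMField.complexConj L) 2)}
    (h𝓕N : IsFundamentalDomain ↥(rationalUnipotent (↥(maximalRealSubfield L)) L (IsCMField.complexConj L) 2) 𝓕 ν) (h𝓕c : IsCompact (closure 𝓕)) (h𝓕₀ : ν 𝓕 ≠ 0) :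
    ∃ C : ℝ, 0 < C ∧
      ∀ {ι α : Type*} {χ : HeckeCharacter L} {φ : α → (quasiSplit (↥(maximalRealSubfield L)) L (IsCMField.complexConj L) 2).Adelic → ℂ} {s : ℂ → ℂ} {f : ι → α → ℝ → ℂ} {σ₀ : ℝ}
        (v : α → Lp ℂ 2 μK) (y : ι → α → Lp ℂ 2 μ),
        χ.IsUnitary → reflectChar (IsCMField.complexConj L) χ = χ →
        (∀ a, IsChiSection χ (φ a)) → (∀ a, Continuous (φ a)) → (∀ a, ∃ Cφ : ℝ, ∀ x, ‖φ a x‖ ≤ Cφ) →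
        (∀ a, (∀ k : (quasiSplit (↥(maximalRealSubfield L)) L (IsCMField.complexConj L) 2).Adelic, adelicVal (↥(maximalRealSubfield L)) L (IsCMField.complexConj L) 2 ((StdForm.antidiagonal 2).over L) k ∈ standardMaximalCompactGL 2 L → ∀ g : (quasiSplit (↥(maximalRealSubfield L)) L (IsCMField.complexConj L) 2).Adelic, φ a (g * k) = φ a g)) → (∀ a, φ a 1 ≠ 0) →
        (∀ a, ∀ z : ℂ, 1 < z.re → s z = (((((ν 𝓕).toReal⁻¹ : ℝ))) : ℂ) * ((φ a 1)⁻¹ * ∫ v : ↥(adelicUnipotent (↥(maximalRealSubfield L)) L (IsCMField.complexConj L) 2), flatSectionU (φ a) z (((quasiSplit (↥(maximalRealSubfield L)) L (IsCMField.complexConj L) 2).toAdelic (weylLongU ((IsCMField.complexConj L : L ≃ₐ[↥(maximalRealSubfield L)] L) : L →+* L) (rfl : (StdForm.antidiagonal 2).over L = (StdForm.antidiagonal 2).over L))) * ((v : (quasiSplit (↥(maximalRealSubfield L)) L (IsCMField.complexConj L) 2).Adelic) * 1)) ∂ν)) → (∀ z : ℂ, 1 < z.re → s (conj z) = conj (s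 z)) →
        (∀ i a, ContDiff ℝ 2 (f i a)) → (∀ i a, HasCompactSupport (f i a)) → (∀ i a, tsupport (f i a) ⊆ Ioi 0) → 1 < σ₀ →
        (∀ a, (v a : ((standardMaximalCompactGL 2 L).comap (adelicVal (↥(maximalRealSubfield L)) L (IsCMField.complexConj L) 2 ((StdForm.antidiagonal 2).over L)) : Subgroup (quasiSplit (↥(maximalRealSubfield L)) L (IsCMField.complexConj L) 2).Adelic) → ℂ) =ᵐ[μK] fun k => φ a (k : (quasiSplit (↥(maximalRealSubfield L)) L (IsCMField.complexConj L) 2).Adelic)) →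
        (∀ i a, (y i a : (quasiSplit (↥(maximalRealSubfield L)) L (IsCMField.complexConj L) 2).automorphicQuotient → ℂ) =ᵐ[μ] (quasiSplit (↥(maximalRealSubfield L)) L (IsCMField.complexConj L) 2).quotFun (eisensteinSeriesU (fun g : (quasiSplit (↥(maximalRealSubfield L)) L (IsCMField.complexConj L) 2).Adelic => f i a (borelHeight g : ℝ) * φ a g))) →
        ∀ i j a b, ⟪y i b, y j a⟫_ℂ = (C : ℂ) * ((((2 * π)⁻¹ : ℝ) : ℂ) * ∫ t : ℝ, mellin (f j a) (-((σ₀ : ℂ) + t * I)) *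
          (⟪(⟨v b, Submodule.subset_span ⟨b, rfl⟩⟩ : ↥(Submodule.span ℂ (Set.range v))), ⟨v a, Submodule.subset_span ⟨a, rfl⟩⟩⟫_ℂ * conj (mellin (f i b) (-(1 - conj ((σ₀ : ℂ) + t * I)))) +
            s ((σ₀ : ℂ) + t * I) * ⟪(⟨v b, Submodule.subset_span ⟨b, rfl⟩⟩ : ↥(Submodule.span ℂ (Set.range v))), ⟨v a, Submodule.subset_span ⟨a, rfl⟩⟩⟫_ℂ *
              conj (mellin (f i b) (-conj ((σ₀ : ℂ) + t * I))))) := by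
  have hH0 := chiPseudoEisenstein_inner_product_selfDual_scalarGram_m1_cm_two L μ νG μK νI h𝓕I ν h𝓕N h𝓕c h𝓕₀
  refine ⟨Classical.choose hH0, (Classical.choose_spec hH0).1, ?_⟩
  intro ι α χ φ s f σ₀ v y hχu hsd hφ hφc hφC hφK hφ1 hs hconj hf hfs hf0 hσ₀ hv hy i j a b
  have h := ((Classical.choose_spec hH0).2 hχu hsd (hφ a) (hφc a) (hφC a).choose_spec (hφ b) (hφc b) (hφC b).choose_spec (hφK b) (hφ1 b) (hs b) hconj (hf j a) (hfs j a) (hf0 j a) (hf i b) (hfs i b) (hf0 i b) hσ₀).2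
  rw [← inner_eq_integral_mul_conj (y i b) (y j a) (hy i b) (hy j a),
    ← inner_mk_span_eq_integral μK v (ψ := fun a (k : ((standardMaximalCompactGL 2 L).comap (adelicVal (↥(maximalRealSubfield L)) L (IsCMField.complexConj L) 2 ((StdForm.antidiagonal 2).over L)) : Subgroup (quasiSplit (↥(maximalRealSubfield L)) L (IsCMField.complexConj L) 2).Adelic)) => φ a (k : (quasiSplit (↥(maximalRealSubfield L)) L (IsCMField.complexConj L) 2).Adelic)) hv a b] at h
  exact h

end Summit.HodgeConjecture.HodgeConjecture.Cruxes.H413.K2E1ChiSectionPlancherelSDGramLetterM1CMTwo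

end
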